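import Literature.MathematicalPhysics.QuantumLattice.HubbardWindowCertificateD4
import Summits.HubbardSuperconductivity.ManyBodyBootstrap.HubbardTorusCommutatorSharp
import HarnessLib

/-!
# Window certificates with PER-TERM regions (literal instance shape of a reduce-mode certificate;
# the support-box torus threshold `L ≥ max(3, D')`)

Cell pub-mbboot (bundle `papers/HubbardSuperconductivity/manybody-bootstrap/`, HOME `run/shared/lean/pub/pub-mbboot/`).
HONEST FRAMING: certified numerical bounds on a lattice model; not superconductivity, not a phase diagram.

The tree's soundness theorem for square-lattice window certificates with affine `D₄` reductions,
`Literature.MathematicalPhysics.QuantumLattice.groundEnergyAt_div_ge_of_window_certificate_d4`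
(Han, arXiv:2006.06002 §3, certified form), states the window identity with ONE inner region `Λ ⊆ Λ'`
carrying every equation-of-motion word `Bₖ` (closure hypothesis `hclosed : Λ ± eᵢ ⊆ Λ'`) and every
symmetry word `Yₗ` (hypothesis `γₗ Λ + wₗ ⊆ Λ'` for every `l`). A reduce-mode certificate of the cell
(format `certsdp/1`, `HOME/certs/FORMAT-certsdp1.md` §2/§5) is not literally of that shape: its
symmetry terms are `m − canon(m)` for monomials `m` anywhere in the support box `B'` of the certificate,
moved by DIFFERENT affine maps `(γₗ, wₗ)`, so no single `Λ` satisfies all the inclusions `γₗ Λ + wₗ ⊆ B'`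
unless `Λ'` is enlarged well beyond `B'` (and its eom words sit on their own small supports). This file
proves the same theorem with PER-TERM regions — `Bₖ ∈ 𝔄(Λᴮₖ)` with `Λᴮₖ ± eᵢ ⊆ Λ'`, and
`Yₗ ∈ 𝔄(Λʸₗ)` with `Λʸₗ ⊆ Λ'`, `γₗ Λʸₗ + wₗ ⊆ Λ'` — by the same proof (the torus-side engine
`hubbardTorus_groundEnergyAt_div_ge_of_local_certificate` is already term-wise):

* `groundEnergyAt_div_ge_of_window_certificate_d4_families` — finite tori: for every `L ≥ 3` with
  `x ↦ x mod L` injective on `Λ'` ITSELF (the SHARP torus hypothesis: the tree theorem asks for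
  injectivity on `thicken Λ' 1`; the gain is this cell's `hubbardTorus_commutator_fermionEmbed_sharp`,
  file `HubbardTorusCommutatorSharp.lean`, which collects the wrap-around bonds of a small torus in an
  extra far term) and every `n ≤ L²`,
  `c − Σₖ ‖aₖ‖ + (Σ_σ μ_σ)(n/L² − ν) ≤ groundEnergyAt (fermionTorusGraph 2 L) t U (2n) / L²`;
* `groundEnergyAt_div_ge_of_window_certificate_d4_families_of_spread` — the same with the injectivity
  hypothesis replaced by the finite check "all coordinate spreads of `Λ'` are `≤ M`" and `L ≥ M + 1`
  (`Torus.proj_injective_of_abs_sub_lt`); for `Λ' = B'` a box of side `D'` this is `M = D' − 1`, i.e.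
  the torus threshold `L ≥ max(3, D')` of `HOME/certs/sdp1/SUPPORT-BOX.md` (column `torus_min_L_sharp`),
  now the literal hypothesis of a kernel-checked theorem rather than a reading of one;
* `energyDensity2D_ge_of_window_certificate_d4_families` — the thermodynamic-limit corollary
  `c − Σₖ ‖aₖ‖ ≤ energyDensity2D t U n` (`ν = n/2`, `0 ≤ U`, `0 ≤ n < 2`);
(The tree's single-region theorem is the instance `Λᴮₖ = Λʸₗ = Λ` of the first — a direct
application, checked while writing this file and omitted to keep it short.)

Dictionary with a reduce-mode certificate file (the file ⇒ identity step is checked by the cell's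
verifiers A/B/C in exact arithmetic, NOT by the kernel — unchanged by this file): `Λ' :=` the support box
`B'` (the bounding box of the supports of every word of the file and of the `±eᵢ`-closure of every eom
word, containing `[-1,1]²`); `O`, `V`, residual and charged words are words of `𝔄(B')`;
`Λᴮₖ := supp(eom word k)`; for every identified pair `αₗ = ±Γ(gₗ) βₗ` of monomials of the file, with the
in-class representative `βₗ` itself a monomial of the file (never the anchored canonical form, which may
leave `B'`), `Λʸₗ := supp(βₗ)`, `Yₗ := ±p_{αₗ} βₗ` and `(γₗ, wₗ) := gₗ`, so that
`γₗ Λʸₗ + wₗ = supp(αₗ) ⊆ B'`. What this file changes is only that the hypothesis SHAPE of the soundness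
theorem now matches such a file term by term, so that its finite-torus validity range is `3 ≤ L`,
`L ≥ D'`, `n ≤ L²` by a kernel-checked statement (the tree's single-region theorem needs one `Λ`
with `γₗ Λ + wₗ ⊆ Λ'` for all `l` at once and `Λ ± eᵢ ⊆ Λ'`, which `Λ' = B'` does not afford). No
certificate instance is kernel-checked here (the headline files have thousands of words).

New mathematics of this cell only in the weak sense of a re-binding of a tree theorem (no published
source states it; the method source is Han 2020 §3): placed under the cell topic
`Summits/HubbardSuperconductivity/ManyBodyBootstrap/` by the cell's placement rule, namespace
`Summit.HubbardSuperconductivity.ManyBodyBootstrap`; it cites the Literature theorem it generalises.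

## References
* X. Han, *Quantum many-body bootstrap*, arXiv:2006.06002 (2020), §2 eq. (2), §3. (bib: Han2020Bootstrap)
* Tree: `Literature/MathematicalPhysics/QuantumLattice/HubbardWindowCertificateD4.lean`
  (`groundEnergyAt_div_ge_of_window_certificate_d4`, `energyDensity2D_ge_of_window_certificate_d4`,
  `fermionEmbed_toTorusEmb_d4_sub`), `HubbardTorusLocalHamiltonianDecomposition.lean`
  (`hubbardTorus_commutator_fermionEmbed`), `HubbardTorusLocalCertificate.lean`
  (`hubbardTorus_groundEnergyAt_div_ge_of_local_certificate`), `TorusCentredLift.lean`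
  (`Torus.proj_injective_of_abs_sub_lt`); this cell's
  `Summits/HubbardSuperconductivity/ManyBodyBootstrap/HubbardTorusCommutatorSharp.lean`
  (`hubbardTorus_commutator_fermionEmbed_sharp`).
-/

noncomputable section

namespace Summit.HubbardSuperconductivity.ManyBodyBootstrap

open Matrix Finset
open Literature.MathematicalPhysics.QuantumLattice
open Literature.Probability.LatticeModels
open HubbardWave0
open Literature.MathematicalPhysics.QuantumManyBody.StateRelaxation
open scoped ComplexOrder BigOperators

section Window

variable {L : ℕ} [NeZero L]

/-- (Local to this section: the decidable equality of torus orbitals used by the orbital-generic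
lemmas of the tree, as in `HubbardWindowCertificateD4`.) -/
local instance (priority := high) instDecidableEqFermionTorusFamilies : DecidableEq (FermionTorus 2 L) :=
  LinearOrder.toDecidableEq

/-- **Window certificate with affine `D₄` reductions and PER-TERM regions ⇒ energy per site of a
square torus.** As `groundEnergyAt_div_ge_of_window_certificate_d4`, but every equation-of-motion word
`Bₖ` lives on its own region `Λᴮₖ` with `Λᴮₖ ± eᵢ ⊆ Λ'`, and every symmetry word `Yₗ` on its own region
`Λʸₗ ⊆ Λ'` with `γₗ Λʸₗ + wₗ ⊆ Λ'`: the window identity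
`Γ(incl) E_Φ − c·1 − Σ_σ μ_σ (n_{0σ} − ν·1) = Σ Λₐᵦ Oₐᴴ O_b + (Σₖ (H_{Λ'} Bₖ − Bₖ H_{Λ'})
   + Σₗ (Γ(incl)(Γ(d4Emb γₗ wₗ) Yₗ) − Γ(incl) Yₗ) + Σⱼ bⱼ • wⱼ) + (Σₘ dₘ • (Vₘᴴ − Vₘ) + Σₖ aₖ • vₖ)`
proves, for every `L ≥ 3` with `x ↦ x mod L` injective on `Λ'` (sharp torus hypothesis; the tree
theorem asks for `thicken Λ' 1`) and every `n ≤ L²`,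
`c − Σₖ ‖aₖ‖ + (Σ_σ μ_σ)(n/L² − ν) ≤ groundEnergyAt (fermionTorusGraph 2 L) t U (2n) / L²`.
Same proof as the tree theorem (Han 2020 §3, certified form); only the binders differ, and the
commutator pull-back is `hubbardTorus_commutator_fermionEmbed_sharp`. -/
theorem groundEnergyAt_div_ge_of_window_certificate_d4_families (t U : ℝ) (hL : 3 ≤ L) {nh : ℕ}
    (hn : nh ≤ Fintype.card (FermionTorus 2 L))
    {Λ' : Finset (Site 2)}
    (h0 : thicken ({0} : Finset (Site 2)) 1 ⊆ Λ') (hz : (0 : Site 2) ∈ Λ')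
    (hInj : Set.InjOn (Torus.proj (d := 2) L) ↑Λ')
    (μ : Fin 2 → ℝ) (ν : ℝ)
    {m : Type*} [Fintype m] [DecidableEq m] {Λm : Matrix m m ℂ} (hΛm : Λm.PosSemidef)
    (O : m → FermionOp Λ')
    {κ : Type*} (s : Finset κ) (ΛB : κ → Finset (Site 2)) (hB : ∀ k, ΛB k ⊆ Λ')
    (hclosedB : ∀ k, ∀ x ∈ ΛB k, ∀ i : Fin 2, x + unitVec i ∈ Λ' ∧ x - unitVec i ∈ Λ')
    (B : (k : κ) → FermionOp (ΛB k))
    {ι : Type*} (tt : Finset ι) (γ : ι → DihedralGroup 4) (wv : ι → Site 2)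
    (ΛY : ι → Finset (Site 2)) (hY : ∀ l, ΛY l ⊆ Λ')
    (hsh : ∀ l, d4ShiftSet (γ l) (wv l) (ΛY l) ⊆ Λ') (Y : (l : ι) → FermionOp (ΛY l))
    {ρ : Type*} (u : Finset ρ) (b : ρ → ℂ) (cw : ρ → List (Orb (PolySite Λ') × Bool))
    (hcw : ∀ j ∈ u, ladderCharge (cw j) ≠ 0 ∨ ladderSpinCharge (cw j) ≠ 0)
    {δ : Type*} (ah : Finset δ) (dc : δ → ℝ) (V : δ → FermionOp Λ')
    {κ'' : Type*} (w : Finset κ'') (a : κ'' → ℂ) (word : κ'' → List (Orb (PolySite Λ') × Bool)) {c : ℝ}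
    (hcert : fermionEmbed (PolySite.incl h0) ((hubbardFermionInteraction 2 t U).meanEnergyObs 1) -
        (c : ℂ) • (1 : FermionOp Λ') -
        ∑ σ : Fin 2, ((μ σ : ℝ) : ℂ) • (nAt 0 hz σ - ((ν : ℝ) : ℂ) • (1 : FermionOp Λ')) =
      gramForm Λm O +
        (∑ k ∈ s, ((hubbardFermionInteraction 2 t U).localHamiltonian Λ' * fermionEmbed (PolySite.incl (hB k)) (B k) -
            fermionEmbed (PolySite.incl (hB k)) (B k) * (hubbardFermionInteraction 2 t U).localHamiltonian Λ') +
          ∑ l ∈ tt, (fermionEmbed (PolySite.incl (hsh l)) (fermionEmbed (PolySite.d4Emb (γ l) (wv l) (ΛY l)) (Y l)) -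
            fermionEmbed (PolySite.incl (hY l)) (Y l)) +
          ∑ j ∈ u, b j • ladderWord (cw j)) +
        (∑ m' ∈ ah, ((dc m' : ℝ) : ℂ) • ((V m')ᴴ - V m') + ∑ k ∈ w, a k • ladderWord (word k))) :
    c - ∑ k ∈ w, ‖a k‖ + (∑ σ : Fin 2, μ σ) * ((nh : ℝ) / (L : ℝ) ^ 2 - ν) ≤
      groundEnergyAt (fermionTorusGraph 2 L) t U (2 * nh) / (L : ℝ) ^ 2 := by
  have hInjY : ∀ l, Set.InjOn (Torus.proj (d := 2) L) ↑(ΛY l) := fun l => hInj.mono (by exact_mod_cast hY l)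
  have hInj0 : Set.InjOn (Torus.proj (d := 2) L) ↑(thicken ({0} : Finset (Site 2)) 1) :=
    hInj.mono (by exact_mod_cast h0)
  set Γ' := fermionEmbed (PolySite.toTorusEmb L hInj) with hΓ'
  set H := hubbardTorus 2 L t U with hH
  set EΦ := (hubbardFermionInteraction 2 t U).meanEnergyObs 1 with hEΦ
  set X := Γ' (fermionEmbed (PolySite.incl h0) EΦ) with hX
  have hX0 : X = fermionEmbed (PolySite.toTorusEmb L hInj0) EΦ := fermionEmbed_toTorusEmb_incl h0 hInj EΦ
  have hsum : ∑ v' : TorusSite 2 L, (fockTranslate v').val * X * (fockTranslate v').valᴴ = H := by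
    rw [hX0]
    have h := sum_relabel_translate_hubbard_meanEnergyObs (d := 2) t U hL
    simp_rw [relabel_eq_fockRelabel_conj] at h
    exact h
  set D : Fin 2 → Matrix (Finset (Orb (FermionTorus 2 L))) (Finset (Orb (FermionTorus 2 L))) ℂ :=
    fun σ => numberOp (FermionTorus.ofTorusSite (0 : TorusSite 2 L)) σ with hD
  set G : Fin 2 → Matrix (Finset (Orb (FermionTorus 2 L))) (Finset (Orb (FermionTorus 2 L))) ℂ :=
    fun σ => ∑ y : FermionTorus 2 L, numberOp y σ with hG
  have hDΓ : ∀ σ, Γ' (nAt 0 hz σ) = D σ := fun σ => fermionEmbed_toTorusEmb_nAt_zero hz hInj σ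
  have hDsum : ∀ σ ∈ (Finset.univ : Finset (Fin 2)),
      ∑ v' : TorusSite 2 L, (fockTranslate v').val * D σ * (fockTranslate v').valᴴ = G σ :=
    fun σ _ => sum_conj_fockTranslate_numberOp 0 σ
  have hGh : ∀ σ ∈ (Finset.univ : Finset (Fin 2)), (G σ).IsHermitian := fun σ _ => isHermitian_sum_numberOp σ
  have hGs : ∀ σ ∈ (Finset.univ : Finset (Fin 2)),
      ∀ ψ ∈ (szSector (2 * nh) 0 : Submodule ℂ (Fock (Orb (FermionTorus 2 L)))),
        G σ *ᵥ ψ = (((nh : ℝ) : ℝ) : ℂ) • ψ := by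
    intro σ _ ψ hψ
    rw [hG, spinNumber_mulVec_of_mem_szSector σ hψ]
    congr 1
    push_cast
    ring
  -- symmetry family: affine `D₄` maps, one region per term
  set Us : ι → Matrix (Finset (Orb (FermionTorus 2 L))) (Finset (Orb (FermionTorus 2 L))) ℂ :=
    fun l => (fockTranslate (Torus.proj L (wv l))).val * (fockD4 (L := L) (γ l)).val with hUs
  set Yt : ι → Matrix (Finset (Orb (FermionTorus 2 L))) (Finset (Orb (FermionTorus 2 L))) ℂ :=
    fun l => fermionEmbed (PolySite.toTorusEmb L (hInjY l)) (Y l) with hYt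
  have hU : ∀ l ∈ tt, Us l * H = H * Us l := fun l _ => d4Affine_mul_hubbardTorus _ _ t U
  have hUK : ∀ l ∈ tt, ∀ ψ ∈ (szSector (2 * nh) 0 : Submodule ℂ (Fock (Orb (FermionTorus 2 L)))),
      Us l *ᵥ ψ ∈ (szSector (2 * nh) 0 : Submodule ℂ (Fock (Orb (FermionTorus 2 L)))) :=
    fun l _ ψ hψ => d4Affine_mulVec_mem_szSector _ _ hψ
  have hUK' : ∀ l ∈ tt, ∀ ψ ∈ (szSector (2 * nh) 0 : Submodule ℂ (Fock (Orb (FermionTorus 2 L)))),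
      (Us l)ᴴ *ᵥ ψ ∈ (szSector (2 * nh) 0 : Submodule ℂ (Fock (Orb (FermionTorus 2 L)))) :=
    fun l _ ψ hψ => d4Affine_conjTranspose_mulVec_mem_szSector _ _ hψ
  have hUU : ∀ l ∈ tt, (Us l)ᴴ * Us l = 1 := fun l _ => d4Affine_conjTranspose_mul_self _ _
  -- charge family
  set emb : Orb (PolySite Λ') × Bool → Orb (FermionTorus 2 L) × Bool :=
    fun p => (Orb.embMap (PolySite.toTorusEmb L hInj) p.1, p.2) with hemb
  set C : ρ → Matrix (Finset (Orb (FermionTorus 2 L))) (Finset (Orb (FermionTorus 2 L))) ℂ :=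
    fun j => if ladderCharge ((cw j).map emb) ≠ 0 then totalNumber else HubbardWave0.spinZ with hC
  set W : ρ → Matrix (Finset (Orb (FermionTorus 2 L))) (Finset (Orb (FermionTorus 2 L))) ℂ :=
    fun j => (b j / (if ladderCharge ((cw j).map emb) ≠ 0 then ((ladderCharge ((cw j).map emb) : ℤ) : ℂ)
      else ((ladderSpinCharge ((cw j).map emb) : ℤ) : ℂ) / 2)) • ladderWord ((cw j).map emb) with hW
  have hHc := hamiltonian_isHermitian_and_commute_holds (fermionTorusGraph 2 L) t U
  have hC1 : ∀ j ∈ u, C j * H = H * C j := by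
    intro j _
    by_cases hq : ladderCharge ((cw j).map emb) ≠ 0
    · simp only [hC, hq, ne_eq, not_false_eq_true, if_true]; exact hHc.2.1.symm.eq
    · simp only [hC, hq, if_false]; exact hHc.2.2.symm.eq
  have hCK : ∀ j ∈ u, ∀ ψ ∈ (szSector (2 * nh) 0 : Submodule ℂ (Fock (Orb (FermionTorus 2 L)))),
      C j *ᵥ ψ ∈ (szSector (2 * nh) 0 : Submodule ℂ (Fock (Orb (FermionTorus 2 L)))) := by
    intro j _ ψ hψ
    obtain ⟨hNψ, hSψ⟩ := (mem_szSector_iff _ _ ψ).1 hψ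
    by_cases hq : ladderCharge ((cw j).map emb) ≠ 0
    · simp only [hC, hq, ne_eq, not_false_eq_true, if_true]
      rw [totalNumber_mulVec_of_isNParticle hNψ]
      exact Submodule.smul_mem _ _ hψ
    · simp only [hC, hq, if_false]
      rw [hSψ]
      exact Submodule.smul_mem _ _ hψ
  have hCh : ∀ j, (C j)ᴴ = C j := by
    intro j
    by_cases hq : ladderCharge ((cw j).map emb) ≠ 0
    · simp only [hC, hq, ne_eq, not_false_eq_true, if_true]
      rw [totalNumber_eq_numberDiag_univ]
      exact numberDiag_conjTranspose _
    · simp only [hC, hq, if_false]; exact HubbardWave0.spinZ_isHermitian.eq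
  have hCK' : ∀ j ∈ u, ∀ ψ ∈ (szSector (2 * nh) 0 : Submodule ℂ (Fock (Orb (FermionTorus 2 L)))),
      (C j)ᴴ *ᵥ ψ ∈ (szSector (2 * nh) 0 : Submodule ℂ (Fock (Orb (FermionTorus 2 L)))) :=
    fun j hj ψ hψ => by rw [hCh j]; exact hCK j hj ψ hψ
  have hcharged : ∀ j ∈ u, Γ' (b j • ladderWord (cw j)) = C j * W j - W j * C j := by
    intro j hj
    rw [map_smul, hΓ', fermionEmbed_ladderWord]
    have hl : ladderCharge ((cw j).map emb) ≠ 0 ∨ ladderSpinCharge ((cw j).map emb) ≠ 0 := by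
      rw [hemb, ladderCharge_map_embMap, ladderSpinCharge_map_embMap]; exact hcw j hj
    exact smul_ladderWord_eq_commutator_of_charged (b j) _ hl
  -- residual words
  set M : κ'' → Matrix (Finset (Orb (FermionTorus 2 L))) (Finset (Orb (FermionTorus 2 L))) ℂ :=
    fun k => ladderWord ((word k).map emb) with hM
  have hMc : ∀ k ∈ w, (M k).IsContraction := fun k _ => by
    rw [hM]; dsimp only; rw [ladderWord_eq_prod]; exact isContraction_prod_ladder _
  -- the identity, pulled back into the torus
  have htorus : X - (c : ℂ) • (1 : Matrix (Finset (Orb (FermionTorus 2 L))) (Finset (Orb (FermionTorus 2 L))) ℂ) -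
      ∑ σ ∈ (Finset.univ : Finset (Fin 2)), ((μ σ : ℝ) : ℂ) • (D σ - ((ν : ℝ) : ℂ) •
        (1 : Matrix (Finset (Orb (FermionTorus 2 L))) (Finset (Orb (FermionTorus 2 L))) ℂ)) =
      gramForm Λm (fun i => Γ' (O i)) +
        (∑ k ∈ s, (H * Γ' (fermionEmbed (PolySite.incl (hB k)) (B k)) -
            Γ' (fermionEmbed (PolySite.incl (hB k)) (B k)) * H) +
          ∑ l ∈ tt, (Us l * Yt l * (Us l)ᴴ - Yt l) +
          ∑ i ∈ (∅ : Finset (Fin 0)), ((0 : Matrix _ _ ℂ) * ((0 : Matrix _ _ ℂ) - (((0 : ℝ) : ℝ) : ℂ) • 1) +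
            ((0 : Matrix _ _ ℂ) - (((0 : ℝ) : ℝ) : ℂ) • 1) * (0 : Matrix _ _ ℂ)) +
          ∑ j ∈ u, (C j * W j - W j * C j)) +
        (∑ m' ∈ ah, ((dc m' : ℝ) : ℂ) • ((Γ' (V m'))ᴴ - Γ' (V m')) + ∑ k ∈ w, a k • M k) := by
    have key := congrArg Γ' hcert
    rw [map_sub, map_sub, map_smul, map_one, map_sum] at key
    have hlhs : ∑ σ : Fin 2, Γ' (((μ σ : ℝ) : ℂ) • (nAt 0 hz σ - ((ν : ℝ) : ℂ) • (1 : FermionOp Λ'))) =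
        ∑ σ ∈ (Finset.univ : Finset (Fin 2)), ((μ σ : ℝ) : ℂ) • (D σ - ((ν : ℝ) : ℂ) •
          (1 : Matrix (Finset (Orb (FermionTorus 2 L))) (Finset (Orb (FermionTorus 2 L))) ℂ)) :=
      Finset.sum_congr rfl fun σ _ => by rw [map_smul, map_sub, map_smul, map_one, hDΓ]
    rw [hlhs] at key
    have h1 : Γ' (∑ k ∈ s, ((hubbardFermionInteraction 2 t U).localHamiltonian Λ' *
          fermionEmbed (PolySite.incl (hB k)) (B k) -
        fermionEmbed (PolySite.incl (hB k)) (B k) * (hubbardFermionInteraction 2 t U).localHamiltonian Λ')) =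
        ∑ k ∈ s, (H * Γ' (fermionEmbed (PolySite.incl (hB k)) (B k)) -
          Γ' (fermionEmbed (PolySite.incl (hB k)) (B k)) * H) := by
      rw [map_sum]
      refine Finset.sum_congr rfl fun k _ => ?_
      rw [hH, hΓ', hubbardTorus_commutator_fermionEmbed_sharp L t U (hB k) (hclosedB k) hInj (B k)]
    have h2 : Γ' (∑ l ∈ tt, (fermionEmbed (PolySite.incl (hsh l))
          (fermionEmbed (PolySite.d4Emb (γ l) (wv l) (ΛY l)) (Y l)) -
        fermionEmbed (PolySite.incl (hY l)) (Y l))) = ∑ l ∈ tt, (Us l * Yt l * (Us l)ᴴ - Yt l) := by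
      rw [map_sum]
      refine Finset.sum_congr rfl fun l _ => ?_
      rw [hUs, hYt, hΓ']
      exact fermionEmbed_toTorusEmb_d4_sub (hY l) (γ l) (wv l) (hsh l) hInj (Y l)
    have h3 : Γ' (∑ j ∈ u, b j • ladderWord (cw j)) = ∑ j ∈ u, (C j * W j - W j * C j) := by
      rw [map_sum]
      exact Finset.sum_congr rfl hcharged
    have h4 : Γ' (∑ m' ∈ ah, ((dc m' : ℝ) : ℂ) • ((V m')ᴴ - V m')) =
        ∑ m' ∈ ah, ((dc m' : ℝ) : ℂ) • ((Γ' (V m'))ᴴ - Γ' (V m')) := by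
      rw [map_sum]
      refine Finset.sum_congr rfl fun m' _ => ?_
      rw [map_smul, map_sub, hΓ', fermionEmbed_conjTranspose]
    have h5 : Γ' (∑ k ∈ w, a k • ladderWord (word k)) = ∑ k ∈ w, a k • M k := by
      rw [map_sum]
      refine Finset.sum_congr rfl fun k _ => ?_
      rw [map_smul, hM, hΓ', fermionEmbed_ladderWord]
    rw [hX, key, map_add, map_add, map_add, map_add, map_add, hΓ', fermionEmbed_gramForm, ← hΓ', h1, h2, h3, h4, h5,
      Finset.sum_empty, add_zero]
  have hmain := hubbardTorus_groundEnergyAt_div_ge_of_local_certificate t U hn X hsum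
    (Finset.univ : Finset (Fin 2)) μ (fun _ => ν) (fun _ => (nh : ℝ)) D G hDsum hGh hGs hΛm
    (fun i => Γ' (O i)) s (fun k => Γ' (fermionEmbed (PolySite.incl (hB k)) (B k))) tt Us Yt hU hUK hUK' hUU
    (∅ : Finset (Fin 0)) (fun _ => 0) (fun _ => 0) (fun _ => 0) (fun _ => 0)
    (fun i hi => absurd hi (Finset.notMem_empty i)) (fun i hi => absurd hi (Finset.notMem_empty i))
    u C W hC1 hCK hCK' ah dc (fun m' => Γ' (V m')) w a M hMc htorus
  have hs : ∑ σ ∈ (Finset.univ : Finset (Fin 2)), μ σ * ((nh : ℝ) / (L : ℝ) ^ 2 - ν) =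
      (∑ σ : Fin 2, μ σ) * ((nh : ℝ) / (L : ℝ) ^ 2 - ν) := by rw [Finset.sum_mul]
  rw [hs] at hmain
  exact hmain

/-- **The support-box torus threshold (sharp).** As
`groundEnergyAt_div_ge_of_window_certificate_d4_families`, with the injectivity hypothesis on
`x ↦ x mod L` replaced by the finite check that all coordinate spreads of `Λ'` are at most `M` together
with `L ≥ M + 1` (`Torus.proj_injective_of_abs_sub_lt`) and `L ≥ 3`. For `Λ'` the support box `B'` of a
reduce-mode certificate, of side `D'` (so `M = D' − 1`), this is the validity range `L ≥ max(3, D')`,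
`n ≤ L²` on finite square tori recorded as `torus_min_L_sharp` in the cell's
`certs/sdp1/SUPPORT-BOX.md` (the earlier reading `L ≥ D' + 2`, column `torus_min_L_tree`, is the range
of the tree's single-region theorem with its `thicken Λ' 1` hypothesis). -/
theorem groundEnergyAt_div_ge_of_window_certificate_d4_families_of_spread (t U : ℝ) (hL : 3 ≤ L)
    {M : ℕ} (hLM : M + 1 ≤ L) {nh : ℕ} (hn : nh ≤ Fintype.card (FermionTorus 2 L))
    {Λ' : Finset (Site 2)} (hspread : ∀ x ∈ Λ', ∀ y ∈ Λ', ∀ j, |x j - y j| ≤ (M : ℤ))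
    (h0 : thicken ({0} : Finset (Site 2)) 1 ⊆ Λ') (hz : (0 : Site 2) ∈ Λ')
    (μ : Fin 2 → ℝ) (ν : ℝ)
    {m : Type*} [Fintype m] [DecidableEq m] {Λm : Matrix m m ℂ} (hΛm : Λm.PosSemidef)
    (O : m → FermionOp Λ')
    {κ : Type*} (s : Finset κ) (ΛB : κ → Finset (Site 2)) (hB : ∀ k, ΛB k ⊆ Λ')
    (hclosedB : ∀ k, ∀ x ∈ ΛB k, ∀ i : Fin 2, x + unitVec i ∈ Λ' ∧ x - unitVec i ∈ Λ')
    (B : (k : κ) → FermionOp (ΛB k))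
    {ι : Type*} (tt : Finset ι) (γ : ι → DihedralGroup 4) (wv : ι → Site 2)
    (ΛY : ι → Finset (Site 2)) (hY : ∀ l, ΛY l ⊆ Λ')
    (hsh : ∀ l, d4ShiftSet (γ l) (wv l) (ΛY l) ⊆ Λ') (Y : (l : ι) → FermionOp (ΛY l))
    {ρ : Type*} (u : Finset ρ) (b : ρ → ℂ) (cw : ρ → List (Orb (PolySite Λ') × Bool))
    (hcw : ∀ j ∈ u, ladderCharge (cw j) ≠ 0 ∨ ladderSpinCharge (cw j) ≠ 0)
    {δ : Type*} (ah : Finset δ) (dc : δ → ℝ) (V : δ → FermionOp Λ')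
    {κ'' : Type*} (w : Finset κ'') (a : κ'' → ℂ) (word : κ'' → List (Orb (PolySite Λ') × Bool)) {c : ℝ}
    (hcert : fermionEmbed (PolySite.incl h0) ((hubbardFermionInteraction 2 t U).meanEnergyObs 1) -
        (c : ℂ) • (1 : FermionOp Λ') -
        ∑ σ : Fin 2, ((μ σ : ℝ) : ℂ) • (nAt 0 hz σ - ((ν : ℝ) : ℂ) • (1 : FermionOp Λ')) =
      gramForm Λm O +
        (∑ k ∈ s, ((hubbardFermionInteraction 2 t U).localHamiltonian Λ' * fermionEmbed (PolySite.incl (hB k)) (B k) -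
            fermionEmbed (PolySite.incl (hB k)) (B k) * (hubbardFermionInteraction 2 t U).localHamiltonian Λ') +
          ∑ l ∈ tt, (fermionEmbed (PolySite.incl (hsh l)) (fermionEmbed (PolySite.d4Emb (γ l) (wv l) (ΛY l)) (Y l)) -
            fermionEmbed (PolySite.incl (hY l)) (Y l)) +
          ∑ j ∈ u, b j • ladderWord (cw j)) +
        (∑ m' ∈ ah, ((dc m' : ℝ) : ℂ) • ((V m')ᴴ - V m') + ∑ k ∈ w, a k • ladderWord (word k))) :
    c - ∑ k ∈ w, ‖a k‖ + (∑ σ : Fin 2, μ σ) * ((nh : ℝ) / (L : ℝ) ^ 2 - ν) ≤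
      groundEnergyAt (fermionTorusGraph 2 L) t U (2 * nh) / (L : ℝ) ^ 2 :=
  have hML : (M : ℤ) < L := by exact_mod_cast (show M < L by omega)
  groundEnergyAt_div_ge_of_window_certificate_d4_families t U hL hn h0 hz
    (fun x hx y hy hxy => Torus.proj_injective_of_abs_sub_lt (fun j => lt_of_le_of_lt (hspread x hx y hy j) hML) hxy)
    μ ν hΛm O s ΛB hB hclosedB B tt γ wv ΛY hY hsh Y u b cw hcw ah dc V w a word hcert

/-- **Window certificate with affine `D₄` reductions and per-term regions ⇒ thermodynamic-limit
energy density of the square-lattice Hubbard model**: with the data of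
`groundEnergyAt_div_ge_of_window_certificate_d4_families` and target density `n ∈ [0,2)` (`ν = n/2`,
`U ≥ 0`), `c − Σₖ ‖aₖ‖ ≤ energyDensity2D t U n`. Same proof as the tree's
`energyDensity2D_ge_of_window_certificate_d4` (Han 2020 §3, certified form). -/
theorem energyDensity2D_ge_of_window_certificate_d4_families (t : ℝ) {U : ℝ} (hU : 0 ≤ U) {n : ℝ}
    (hn0 : 0 ≤ n) (hn2 : n < 2)
    {Λ' : Finset (Site 2)}
    (h0 : thicken ({0} : Finset (Site 2)) 1 ⊆ Λ') (hz : (0 : Site 2) ∈ Λ')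
    (μ : Fin 2 → ℝ)
    {m : Type*} [Fintype m] [DecidableEq m] {Λm : Matrix m m ℂ} (hΛm : Λm.PosSemidef)
    (O : m → FermionOp Λ')
    {κ : Type*} (s : Finset κ) (ΛB : κ → Finset (Site 2)) (hB : ∀ k, ΛB k ⊆ Λ')
    (hclosedB : ∀ k, ∀ x ∈ ΛB k, ∀ i : Fin 2, x + unitVec i ∈ Λ' ∧ x - unitVec i ∈ Λ')
    (B : (k : κ) → FermionOp (ΛB k))
    {ι : Type*} (tt : Finset ι) (γ : ι → DihedralGroup 4) (wv : ι → Site 2)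
    (ΛY : ι → Finset (Site 2)) (hY : ∀ l, ΛY l ⊆ Λ')
    (hsh : ∀ l, d4ShiftSet (γ l) (wv l) (ΛY l) ⊆ Λ') (Y : (l : ι) → FermionOp (ΛY l))
    {ρ : Type*} (u : Finset ρ) (b : ρ → ℂ) (cw : ρ → List (Orb (PolySite Λ') × Bool))
    (hcw : ∀ j ∈ u, ladderCharge (cw j) ≠ 0 ∨ ladderSpinCharge (cw j) ≠ 0)
    {δ : Type*} (ah : Finset δ) (dc : δ → ℝ) (V : δ → FermionOp Λ')
    {κ'' : Type*} (w : Finset κ'') (a : κ'' → ℂ) (word : κ'' → List (Orb (PolySite Λ') × Bool)) {c : ℝ}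
    (hcert : fermionEmbed (PolySite.incl h0) ((hubbardFermionInteraction 2 t U).meanEnergyObs 1) -
        (c : ℂ) • (1 : FermionOp Λ') -
        ∑ σ : Fin 2, ((μ σ : ℝ) : ℂ) • (nAt 0 hz σ - ((n / 2 : ℝ) : ℂ) • (1 : FermionOp Λ')) =
      gramForm Λm O +
        (∑ k ∈ s, ((hubbardFermionInteraction 2 t U).localHamiltonian Λ' * fermionEmbed (PolySite.incl (hB k)) (B k) -
            fermionEmbed (PolySite.incl (hB k)) (B k) * (hubbardFermionInteraction 2 t U).localHamiltonian Λ') +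
          ∑ l ∈ tt, (fermionEmbed (PolySite.incl (hsh l)) (fermionEmbed (PolySite.d4Emb (γ l) (wv l) (ΛY l)) (Y l)) -
            fermionEmbed (PolySite.incl (hY l)) (Y l)) +
          ∑ j ∈ u, b j • ladderWord (cw j)) +
        (∑ m' ∈ ah, ((dc m' : ℝ) : ℂ) • ((V m')ᴴ - V m') + ∑ k ∈ w, a k • ladderWord (word k))) :
    c - ∑ k ∈ w, ‖a k‖ ≤ ThermodynamicLimit.energyDensity2D t U n := by
  obtain ⟨L₀, hL₀⟩ := exists_forall_le_injOn_proj Λ'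
  refine ThermodynamicLimit.energyDensity2D_ge_of_eventually_ge_torus t hU hn0 hn2
    (μ := (∑ σ : Fin 2, μ σ) / 2) ?_
  filter_upwards [Filter.eventually_ge_atTop (max L₀ 3)] with L hL
  have hL3 : 3 ≤ L := le_trans (le_max_right _ _) hL
  have hLL : L₀ ≤ L := le_trans (le_max_left _ _) hL
  haveI : NeZero L := ⟨by omega⟩
  set nh : ℕ := ⌊n * (L : ℝ) ^ 2 / 2⌋₊ with hnh
  have hrect : ThermodynamicLimit.rectN n L = 2 * nh := rfl
  have hn : nh ≤ Fintype.card (FermionTorus 2 L) := by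
    have h := ThermodynamicLimit.rectN_le_two_mul hn0 hn2.le L
    rw [hrect] at h
    have hcard : Fintype.card (FermionTorus 2 L) = L ^ 2 := by simp [FermionTorus]
    rw [hcard, sq]
    omega
  have hmain := groundEnergyAt_div_ge_of_window_certificate_d4_families t U hL3 hn h0 hz (hL₀ L hLL) μ (n / 2)
    hΛm O s ΛB hB hclosedB B tt γ wv ΛY hY hsh Y u b cw hcw ah dc V w a word hcert
  have key : c - ∑ k ∈ w, ‖a k‖ + (∑ σ : Fin 2, μ σ) / 2 * ((((2 * nh : ℕ) : ℝ)) / (L : ℝ) ^ 2 - n) =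
      c - ∑ k ∈ w, ‖a k‖ + (∑ σ : Fin 2, μ σ) * ((nh : ℝ) / (L : ℝ) ^ 2 - n / 2) := by
    push_cast
    ring
  rw [hrect, key]
  exact hmain

end Window

end Summit.HubbardSuperconductivity.ManyBodyBootstrap
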